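import Summits.Ventures.PercRepro.RankLevelSetLevelSixHeavySq28CLo
import Summits.Ventures.PercRepro.RankLevelSetLevelSixHeavySq28CHi
import Summits.Ventures.PercRepro.S3SixWindow
import Summits.Ventures.PercRepro.RankLevelSetCoreSixLowSelfDG



/-!
# PercRepro — THEOREM C₆ WITH THE CUBIC MULTIPLICITY, THE DISJOINT PAIR COUNT, THE WINDOWED HEAVY TERM AND THE CIRCUIT TABLES: LEVEL `5` AT `27` ⇒ C-025 AT
LEVEL `6` FOR EVERY `p ≥ 28`, AND `c025_six_large_twenty_eight (28 ≤ p) : RLS M p 6` UNCONDITIONAL (p8 g6, S3)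

`proofs/SUBCLAIM-S3-p8.md` §3s. The level-`6` row on the cell theorem `c025_core_six_heavy_cell_sq28c` (RankLevelSetLevelSixHeavyCellSq28C: flat bounds
`39 / 19`, p4's CUBIC MULTIPLICITY — fibre weights `1/cube(j + 1)`, `cube ν = ν(ν² + 1)/2` = `1, 1/5, 1/15, 1/34, 1/65, …` (RankLevelSetMultCubeCount on
`S2.card_pairs_ge_cube`), rational tails in the level-by-level form (the crude form at `d = 15`), THE WINDOWED HEAVY TERM, THE DISJOINT PAIR COUNT
`P(n) = s₃·C(n − 3, 4) + s₄·C(n − 4, 3) + s₅·C(n − 5, 2) + s₆·(n − 6) + s₇` with `s₃ ≤ c3`, `s₄ ≤ c4`, `s₅ ≤ c5` as hypotheses), with the circuit bounds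
p3's `cq3` table (`s₃ ≤ cq3 d` at `d ≤ 29`, TriangleCapEightI), p1's LEMMA T⁺⁺⁺ (`s₃ ≤ (d² − 3d + 6)/2` beyond, S1TrianglePlusSharp), p1's unconditional `s₄ ≤ 85 / 122` at `d = 7 / 8` (S1CoreCapUncond) with the averaging recursion `170 / 231 / 308 / 402` at `d = 9 … 12` (RankLevelSetFourCircuitAvgExt) and the 4-circuit table beyond (S1CoreFourCircuitSum), the 5-circuit averaging table `432 / 702 / 1092 / 1638 / 2382 / 3374` at `d = 7 … 12` (RankLevelSetFiveCircuitAvg) and the crude `C(d + 4, 5)` beyond. Every core cell `(p, 7 ≤ d ≤ 51)` at `p ≥ 28` by the cell theorem with the per-corank parameters of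
RankLevelSetLevelSixArithHeavySq28CA … W (`c025_core_six_bounded_corank_heavy_sq28c`); the cells `d ≥ 52` by
`c025_core_six_thirtynine_twenty_eight'` (RankLevelSetCoreSixLowSelfDG: the regime-II cells with the cube count up to `n = 91` and the corank key from `n₀ = 92`); level `5` for
`p ≥ 27` gives level `6` for `p ≥ 28` (`c025_six_of_five_heavy_sq28c`: rank `28` by `rls_six_at_of_core`, ranks `≥ 29` by
`rls_succ_large`). The UNCONDITIONAL row `c025_six_large_twenty_eight (28 ≤ p)` follows in RankLevelSetLevelSixHeavySq28CAll the minute a level-`5` row from `27` is in the tree (p7's `c025_five_large_three30` / the sharp chain). Axioms: standard.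
-/

open scoped Matroid

namespace PercRepro

namespace ThmN

open Set

variable {α : Type}

/-- **The `e`-free core at level `6`, corank `7 ≤ d ≤ 51`, rank `p ≥ 28`**: the two halves. -/
theorem c025_core_six_bounded_corank_heavy_sq28c (M : Matroid α) [M.Finite] (p d : ℕ) (hp : 28 ≤ p) (hd7 : 7 ≤ d)
    (hd51 : d ≤ 51) (hR : M.eRank = (p : ℕ∞)) (hn : M.E.ncard = p + d)
    (hfree : ∀ e ∈ M.E, ∃ A ⊆ M.E \ {e}, e ∉ M.closure A ∧ e ∉ M.closure ((M.E \ {e}) \ A)) :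
    RLS M p 6 := by
  rcases Nat.lt_or_ge d 32 with h | h
  · exact c025_core_six_bounded_corank_heavy_sq28c_lo M p d hp hd7 (by omega) hR hn hfree
  · exact c025_core_six_bounded_corank_heavy_sq28c_hi M p d hp h hd51 hR hn hfree

/-- **THEOREM C₆ WITH THE CUBIC MULTIPLICITY, THE DISJOINT PAIR COUNT, THE WINDOWED HEAVY TERM AND THE CIRCUIT TABLES, GIVEN LEVEL `5`**:
level `5` for all `p ≥ 27` implies level `6` for all `p ≥ 28`. -/
theorem c025_six_of_five_heavy_sq28c (h5 : ∀ (M : Matroid α) [M.Finite] (p : ℕ), 27 ≤ p → RLS M p 5) :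
    ∀ (M : Matroid α) [M.Finite] (p : ℕ), 28 ≤ p → RLS M p 6 := by
  intro M _ p hp
  rcases Nat.lt_or_ge p 29 with hlt | hge
  · have hP : p = 28 := by omega
    subst hP
    refine rls_six_at_of_core 28 (by norm_num) (fun M _ => h5 M 27 (by norm_num)) ?_ M
    intro M _ d hd hR hn hfree
    rcases Nat.lt_or_ge d 52 with hd51 | hd52
    · exact c025_core_six_bounded_corank_heavy_sq28c M 28 d (by norm_num) hd (by omega) hR hn hfree
    · exact c025_core_six_thirtynine_twenty_eight' M 28 (by norm_num) hR (by omega) hfree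
  · refine rls_succ_large (α := α) 5 6 28 ?_ ?_ ?_ M p hge (by omega)
    · intro M' _ p' hP _
      exact h5 M' p' (by omega)
    · intro M' _ p' _ hn _
      rcases Nat.lt_or_ge M'.E.ncard (p' + 6) with h | h
      · exact RLS_of_ncard_lt M' h
      · exact RLS_of_ncard_eq M' (by omega)
    · intro M' _ p' hP hR hbig _ hfree
      rcases Nat.lt_or_ge M'.E.ncard (p' + 52) with h | h
      · exact c025_core_six_bounded_corank_heavy_sq28c M' p' (M'.E.ncard - p') hP (by omega) (by omega) hR (by omega) hfree
      · exact c025_core_six_thirtynine_twenty_eight' M' p' (by omega) hR (by omega) hfree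

end ThmN

end PercRepro
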